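import Summits.BirchSwinnertonDyer.BirchSwinnertonDyer.Theorems.EisensteinPrimesBSDpOnCellCStubC3RoadHTorsion
import Summits.BirchSwinnertonDyer.Rank1Residual.X2.NonsplitControl
import Summits.BirchSwinnertonDyer.Rank1Residual.X2.SplitHalvesAssembly
import HarnessLib

/-!
# Crux 4 `BSDpOnCellC` (stmt-BirchSwinnertonDyer-19034), line b1 (v7 `61c171a5`), stub `stub_c3`: road H's
# TORSION input is a THEOREM at the non-split sign (control theorem p398508) and = CTL-split at the split
# sign — `stub_c3` from PUBLISHED facts + road-H member data + CTL-split + Keller–Yin D′ (cell `bsd-eis`,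
# seat `bsd-eis-c3h` g0)

HONEST FRAMING (cell `bsd-eis`, run/shared/lean/pub/bsd-eis/): theorems only; nothing booked; X2 stays
CONSTRUCTION-SHAPED; no label or count moves; BSD is not proved by any of this. CONDITIONAL on: seven
PUBLISHED facts (GZK, newform existence, Poitou–Tate ×2, local Euler–Poincaré, `cd ≤ 2`, Brink — conjuncts
of line b1's `stub_publishedFacts`), road H's MEMBER DATA (hypothesis-shaped, stated inline on the binders of
`X2.HidaLimitInputsIntAt`; provenance KY §5.1 (a)–(e) [PRE] + cgshw MEMO-8/MEMO-9 + Cas20 §1.5), CTL-split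
`X2.SplitControlOnTree W p` at the split pairs (the first disjunct of the registered `stub_ctlOrSwitch`; a
THEOREM when `E(ℚ_p)[p] = 0`, p434550), and KY D′♭ at each sign [PRE].

## What

`Theorems/EisensteinPrimesBSDpOnCellCStubC3RoadHTorsion.lean` reduced road H's typed inputs to
[`X_ac^∅` is `Λ`-torsion] ∧ [member data] (Keller–Yin Lemma 5.1.2 discharged in the kernel,
`Theorems/EisensteinPrimesHidaLimitFittingBound.lean`). The torsion clause is itself in the kernel at the
X2c Heegner data:

* NON-split sign: the control theorem `X2.controlOnTreeAt_of_not_split_of_rankOne` (p398508; Cas18 Thm. 2.3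
  shape, JSW §3.3 atoms, Brink; NO irreducibility, NO Keller–Yin App. B) yields `ControlOnTreeAt`, whose
  first conjunct `XAc.HasCharValuationAt … n` carries `Module.IsTorsion Λ X_ac^∅` —
  `isTorsion_xAc_of_cellC_of_not_split`;
* SPLIT sign: `X2.SplitControlOnTree W p` (CTL-split) yields the same — `isTorsion_xAc_of_splitControlOnTree`.

Hence **`stub_c3_of_memberDataInt_of_splitControl_of_muLambdaInt`**: the registered `stub_c3` signature
VERBATIM from [PUB ×7] + [member data at every X2c pair] + [CTL-split at the split pairs] + [D′♭ at each sign].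
In stub currency for the item OWNER: on the ¬split B11 cells road H's residual for c3♭ is EXACTLY the three
member-data fields ((α)+control, (d), (b)♭) + D′; on the split cells additionally CTL-split (already a
registered stub's disjunct). What this is NOT: not a proof of any member-data field, of CTL-split, or of D′.

References: [Castella2018] Thm. 2.3 (arXiv:1704.06608 p. 5); [JetchevSkinnerWan2017] §3.3; [Brink2007] Thm. 2;
[KellerYin2024] §5.1, Lemma 5.1.2, Thm. 5.1.3 (arXiv:2402.12781v2, PRE); [Skinner2016PacificMC] §3.1; cell
memos cgshw MEMO-7/8/9/10.
-/

set_option autoImplicit false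
set_option linter.dupNamespace false

noncomputable section

open scoped Classical MatrixGroups ModularForm

open CongruenceSubgroup WeierstrassCurve NumberField IsDedekindDomain Field PowerSeries
  Literature.RingTheory.FittingIdeal
  Literature.NumberTheory.EllipticCurves Literature.NumberTheory.EllipticCurves.GreenbergSelmer
  Literature.NumberTheory.EllipticCurves.ModularForms
  Literature.NumberTheory.EllipticCurves.Rank1Residual
  Literature.NumberTheory.EllipticCurves.Rank1Residual.Typed
  Literature.NumberTheory.GaloisRepresentations Literature.NumberTheory.GaloisCohomology
  Literature.NumberTheory.Automorphic
  Summit.BirchSwinnertonDyer.Rank1Residual.X11b.AcSelmer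
  Summit.BirchSwinnertonDyer.Rank1Residual.X11b.Halves
  Summit.BirchSwinnertonDyer.Rank1Residual.X11b
  Summit.BirchSwinnertonDyer.Rank1Residual.X2

namespace Summit.BirchSwinnertonDyer.BirchSwinnertonDyer.Theorems

/-! ### §1 The torsion clause at the X2c Heegner data, both signs -/

section Torsion

variable {W : WeierstrassCurve ℚ} [W.IsElliptic] [W.IsGloballyMinimal] {p : ℕ} [Fact p.Prime]

/-- **`X_ac^∅(E[p^∞])` is `Λ`-torsion at a NON-split X2c datum, FROM PUBLISHED FACTS.** For a CellC pair
`(E, p)` with `p` non-split multiplicative, `K` imaginary quadratic in which `p` splits, `L(E^{d_K},1) ≠ 0`,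
a non-torsion `P ∈ E(K)`, anticyclotomic `κ` with generator `γ`, degree-one `𝔭 ∋ p`: the control theorem
`X2.controlOnTreeAt_of_cellC_of_not_split` (p398508's `controlOnTreeAt_of_not_split_of_rankOne` in CellC
currency) gives `ControlOnTreeAt`, whose `HasCharValuationAt` conjunct begins with `Module.IsTorsion Λ X_ac^∅`. CONDITIONAL on the seven cited facts; nothing booked.
[cite: Castella2018, Thm. 2.3 (arXiv:1704.06608 p. 5), first clause]
[cite: JetchevSkinnerWan2017, Thm. 3.3.1 and §3.3.5 (arXiv:1512.06894 pp. 10–13)] [cite: Brink2007, Thm. 2 and Cor. 1] -/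
theorem isTorsion_xAc_of_cellC_of_not_split
    (hGZK : rank_eq_analyticRank_of_analyticRank_le_one) (hnf : exists_isNewformOf)
    (hPT : ∀ (K : Type) [Field K] [NumberField K], poitouTate_selmerStructure_duality K)
    (hPT2 : ∀ (K : Type) [Field K] [NumberField K], poitouTate_sha_tateDual K)
    (hEP : ∀ (K : Type) [Field K] [NumberField K] (v : HeightOneSpectrum (𝓞 K)),
      localEulerPoincareCharacteristic (v.adicCompletion K))
    (hcd : fieldCdLE_two_of_numberField)
    (hBr : ∀ (K : Type) [Field K] [NumberField K] (p : ℕ) [Fact p.Prime],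
      ZpExtension.decomp_not_le_kerSubgroup_of_isAnticyclotomic K p)
    (hc : CellC W p) (hns : ¬ W.HasSplitMultiplicativeReductionAtPrime p)
    {K : Type} [Field K] [NumberField K] (hK : IsImaginaryQuadratic K)
    (hsplit : SatisfiesHeegnerHypothesis p K)
    (hLt : (W.quadraticTwist (NumberField.discr K : ℚ)).entireLFunction 1 ≠ 0)
    (P : (W.baseChange K).toAffine.Point) (hPinf : ¬ IsOfFinAddOrder P)
    (κ : ZpExtension K p) (hκ : κ.IsAnticyclotomic) (γ : absoluteGaloisGroup K)
    [Fact (κ.IsTopGenerator γ)] (𝔭 : HeightOneSpectrum (𝓞 K))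
    (h𝔭 : ((p : ℕ) : 𝓞 K) ∈ 𝔭.asIdeal) (he : 𝔭.asIdeal.ramificationIdx (𝓞 ℚ) = 1)
    (hf : 𝔭.asIdeal.inertiaDeg (𝓞 ℚ) = 1) :
    Module.IsTorsion (IwasawaAlgebra p) (XAc (W.baseChange K) p κ 𝔭 ∅ γ) := by
  obtain ⟨n, hn, -⟩ := controlOnTreeAt_of_cellC_of_not_split W p hGZK hnf hPT hPT2 hEP hcd hBr hc hns
    hK hsplit hLt P hPinf κ hκ γ 𝔭 h𝔭 he hf
  exact hn.1

/-- **`X_ac^∅(E[p^∞])` is `Λ`-torsion at a SPLIT X2c datum, FROM CTL-split.** `X2.SplitControlOnTree W p`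
(the anticyclotomic control statement at a split X2c pair; the first disjunct of the registered
`stub_ctlOrSwitch`, a theorem when `E(ℚ_p)[p] = 0` by `X2.splitControlOnTree_of_cellC_of_noPadicPTorsion`,
p434550) gives `ControlOnTreeAt`, whose first conjunct carries the torsion clause. CONDITIONAL; nothing booked.
[cite: Castella2018, Thm. 2.3 (arXiv:1704.06608 p. 5), first clause (shape only)] -/
theorem isTorsion_xAc_of_splitControlOnTree (hCTL : SplitControlOnTree W p)
    (hc : CellC W p) (hs : W.HasSplitMultiplicativeReductionAtPrime p)
    {K : Type} [Field K] [NumberField K] (hK : IsImaginaryQuadratic K)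
    (hsplit : SatisfiesHeegnerHypothesis p K)
    (hLt : (W.quadraticTwist (NumberField.discr K : ℚ)).entireLFunction 1 ≠ 0)
    (P : (W.baseChange K).toAffine.Point) (hPinf : ¬ IsOfFinAddOrder P)
    (κ : ZpExtension K p) (hκ : κ.IsAnticyclotomic) (γ : absoluteGaloisGroup K)
    [Fact (κ.IsTopGenerator γ)] (𝔭 : HeightOneSpectrum (𝓞 K))
    (h𝔭 : ((p : ℕ) : 𝓞 K) ∈ 𝔭.asIdeal) (he : 𝔭.asIdeal.ramificationIdx (𝓞 ℚ) = 1)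
    (hf : 𝔭.asIdeal.inertiaDeg (𝓞 ℚ) = 1) :
    Module.IsTorsion (IwasawaAlgebra p) (XAc (W.baseChange K) p κ 𝔭 ∅ γ) := by
  obtain ⟨n, hn, -⟩ := hCTL K P hc hs hK hsplit hLt hPinf κ hκ γ 𝔭 h𝔭 he hf
  exact hn.1

end Torsion

/-! ### §2 `stub_c3` VERBATIM from PUB facts + member data + CTL-split + Keller–Yin D′ -/

section StubC3

/-- **`stub_c3` (line b1 v7, crux 4 `BSDpOnCellC`) FROM [PUB ×7] + [road-H member data at every X2c pair]
+ [CTL-split at the split pairs] + [KELLER–YIN D′♭ at each sign].** The torsion clause of road H's inputs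
is DISCHARGED: at a non-split pair by `isTorsion_xAc_of_cellC_of_not_split` (control theorem p398508, PUB
inputs `hGZK hnf hPT hPT2 hEP hcd hBr`), at a split pair by `isTorsion_xAc_of_splitControlOnTree` from
`hCTL` (CTL-split = the first disjunct of `stub_ctlOrSwitch`); the finite-submodule bound by
`exists_span_C_pow_mul_span_le_fittingIdeal_zero` (Keller–Yin Lemma 5.1.2 in the kernel). The member data
`hmem` are stated INLINE on the binders of `X2.HidaLimitInputsIntAt` (no new `Prop`): `∀ m ≥ 1 ∃ N_m, Q_m`
with `X_ac^∅/p^m ≅ N_m/p^m` [(α) + control], `Fitt_Λ(N_m)·𝓞_{ℂ_p}⟦T⟧ ⊆ (Q_m)` [(d)], `(Q_m) + (p)^m =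
(Q) + (p)^m` [(b)♭]. Conclusion: the registered `stub_c3` signature VERBATIM (via
`stub_c3_of_isTorsion_of_memberDataInt_of_muLambdaInt`). So on the ¬split B11 cells road H's typed
residual for the IMC atom is EXACTLY the three member-data fields + D′; on the split cells + CTL-split.
CONDITIONAL-RESULT (typed ≠ proved ≠ endorsed); nothing booked; no label or count moves.
[claim: KellerYin2024, status: under-review]
[cite: KellerYin2024, §5.1 (a)–(e), Thm. 5.1.3 = Thm. D (arXiv:2402.12781v2)]
[cite: Castella2018, Thm. 2.3 (arXiv:1704.06608 p. 5)] [cite: Skinner2016PacificMC, §3.1 (p. 192)] -/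
theorem stub_c3_of_memberDataInt_of_splitControl_of_muLambdaInt
    (hGZK : rank_eq_analyticRank_of_analyticRank_le_one) (hnf : exists_isNewformOf)
    (hPT : ∀ (K : Type) [Field K] [NumberField K], poitouTate_selmerStructure_duality K)
    (hPT2 : ∀ (K : Type) [Field K] [NumberField K], poitouTate_sha_tateDual K)
    (hEP : ∀ (K : Type) [Field K] [NumberField K] (v : HeightOneSpectrum (𝓞 K)),
      localEulerPoincareCharacteristic (v.adicCompletion K))
    (hcd : fieldCdLE_two_of_numberField)
    (hBr : ∀ (K : Type) [Field K] [NumberField K] (p : ℕ) [Fact p.Prime],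
      ZpExtension.decomp_not_le_kerSubgroup_of_isAnticyclotomic K p)
    (hmem : ∀ (W : WeierstrassCurve ℚ) [W.IsElliptic] [W.IsGloballyMinimal] (p : ℕ) [Fact p.Prime],
      CellC W p →
      ∀ (N : ℕ) [NeZero N] (K : Type) [Field K] [NumberField K] (Dt : ModularParametrizationData W N)
        (H : HeegnerDatum N (NumberField.discr K)) (ιK : K →+* ℂ) (P : (W.baseChange K).toAffine.Point),
        CellC W p → W.conductorNorm ℤ = N →
        IsImaginaryQuadratic K → NumberField.discr K < -4 → SatisfiesHeegnerHypothesis N K →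
        (W.quadraticTwist (NumberField.discr K : ℚ)).entireLFunction 1 ≠ 0 →
        WeierstrassCurve.Affine.Point.map ιK.toRatAlgHom P = heegnerPointComplex Dt H →
        ¬ (p : ℤ) ∣ Dt.c → ¬ IsOfFinAddOrder P →
        ∀ (κ : ZpExtension K p), κ.IsAnticyclotomic →
          ∀ (γ : Field.absoluteGaloisGroup K) [Fact (κ.IsTopGenerator γ)]
            (𝔭 : HeightOneSpectrum (𝓞 K)), ((p : ℕ) : 𝓞 K) ∈ 𝔭.asIdeal →
            𝔭.asIdeal.ramificationIdx (𝓞 ℚ) = 1 → 𝔭.asIdeal.inertiaDeg (𝓞 ℚ) = 1 →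
            ∀ (f : CuspForm (CongruenceSubgroup.Gamma0 N) 2), IsNewformOf W f →
              ∀ (ι' : PadicAlgCl p ≃+* ℂ),
                (∀ (w : InfinitePlace K) (k : 𝓞 K),
                  k ∈ 𝔭.asIdeal ↔ ‖ι'.symm (w.embedding (k : K))‖ < 1) →
                ∀ (ΩK : ℂ) (Ωp : ℂ_[p]) (Q : PowerSeries 𝓞_ℂ_[p]), ΩK ≠ 0 → ‖Ωp‖ = 1 →
                  R1.IsBDPLFunctionInt p ι' 𝔭 κ γ f ΩK Ωp Q →
                    ∀ m : ℕ, 1 ≤ m →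
                      ∃ (Nm : Type) (_ : AddCommGroup Nm) (_ : Module (IwasawaAlgebra p) Nm)
                        (_ : Module.Finite (IwasawaAlgebra p) Nm) (Qm : PowerSeries 𝓞_ℂ_[p]),
                        Nonempty (((XAc (W.baseChange K) p κ 𝔭 ∅ γ) ⧸
                            ((Ideal.span {(C (p : ℤ_[p]) : IwasawaAlgebra p)}) ^ m •
                              (⊤ : Submodule (IwasawaAlgebra p) (XAc (W.baseChange K) p κ 𝔭 ∅ γ))))
                            ≃ₗ[IwasawaAlgebra p]
                          (Nm ⧸ ((Ideal.span {(C (p : ℤ_[p]) : IwasawaAlgebra p)}) ^ m •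
                            (⊤ : Submodule (IwasawaAlgebra p) Nm)))) ∧
                        (Module.fittingIdeal (IwasawaAlgebra p) Nm 0).map
                            (PowerSeries.map (R1.toCpInt p)) ≤ Ideal.span {Qm} ∧
                        Ideal.span {Qm} ⊔
                            (Ideal.span {(C ((p : ℕ) : 𝓞_ℂ_[p]) : PowerSeries 𝓞_ℂ_[p])}) ^ m =
                          Ideal.span {Q} ⊔
                            (Ideal.span {(C ((p : ℕ) : 𝓞_ℂ_[p]) : PowerSeries 𝓞_ℂ_[p])}) ^ m)
    (hCTL : ∀ (W : WeierstrassCurve ℚ) [W.IsElliptic] [W.IsGloballyMinimal] (p : ℕ) [Fact p.Prime],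
      CellC W p → W.HasSplitMultiplicativeReductionAtPrime p → SplitControlOnTree W p)
    (hml : ∀ (W : WeierstrassCurve ℚ) [W.IsElliptic] [W.IsGloballyMinimal] (p : ℕ) [Fact p.Prime],
      CellC W p → ¬ W.HasSplitMultiplicativeReductionAtPrime p → NonsplitMuLambdaOnTreeInt W p)
    (hmls : ∀ (W : WeierstrassCurve ℚ) [W.IsElliptic] [W.IsGloballyMinimal] (p : ℕ) [Fact p.Prime],
      CellC W p → W.HasSplitMultiplicativeReductionAtPrime p → SplitMuLambdaOnTreeInt W p) :
    (∀ (W : WeierstrassCurve ℚ) [W.IsElliptic] [W.IsGloballyMinimal] (p : ℕ) [Fact p.Prime],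
      CellC W p → ¬ W.HasSplitMultiplicativeReductionAtPrime p → NonsplitIMCEqOnTreeInt W p) ∧
    (∀ (W : WeierstrassCurve ℚ) [W.IsElliptic] [W.IsGloballyMinimal] (p : ℕ) [Fact p.Prime],
      CellC W p → W.HasSplitMultiplicativeReductionAtPrime p → SplitIMCEqOnTreeInt W p) := by
  refine stub_c3_of_isTorsion_of_memberDataInt_of_muLambdaInt (fun W _ _ p _ hc => ?_) hml hmls
  intro N _ K _ _ Dt H ιK P hc' hN hK hd4 hHN hLt hP hcM hPinf κ hκ γ _ 𝔭 h𝔭 he hf f hfW ι' hι' ΩK Ωp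
    Q hΩK hΩp hQ
  refine ⟨?_, hmem W p hc N K Dt H ιK P hc' hN hK hd4 hHN hLt hP hcM hPinf κ hκ γ 𝔭 h𝔭 he hf f hfW
    ι' hι' ΩK Ωp Q hΩK hΩp hQ⟩
  -- `p ∣ N` (multiplicative reduction), so `p` splits in `K` (Heegner hypothesis for `N`)
  have hpN : p ∣ N := hN ▸ Summit.BirchSwinnertonDyer.Rank1Residual.X11b.dvd_conductorNorm_of_mult (W := W) hc.2.2.2
  have hsplitp : SatisfiesHeegnerHypothesis p K := fun q hq hqp => hHN q hq (hqp.trans hpN)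
  by_cases hs : W.HasSplitMultiplicativeReductionAtPrime p
  · exact isTorsion_xAc_of_splitControlOnTree (hCTL W p hc hs) hc hs hK hsplitp hLt P hPinf κ hκ γ 𝔭
      h𝔭 he hf
  · exact isTorsion_xAc_of_cellC_of_not_split hGZK hnf hPT hPT2 hEP hcd hBr hc hs hK hsplitp hLt P
      hPinf κ hκ γ 𝔭 h𝔭 he hf

end StubC3

end Summit.BirchSwinnertonDyer.BirchSwinnertonDyer.Theorems

end
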